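import Literature.Probability.LatticeModels.SplitFailureBound
import Literature.Probability.LatticeModels.MixingBoxConcentration
import Literature.Probability.LatticeModels.CrossingNumerics
import Literature.Probability.LatticeModels.IntersectionClusteringBound
import Literature.Probability.LatticeModels.RandomCurrentsMixingEndgame
import HarnessLib

/-!
# Lemma 6.7 in a finite volume of `ℤ⁴`: the split-event error through the infinite-volume two-point function

Topic `Literature/Probability/LatticeModels`. Theorems only; **no named fact is introduced** (D-0026).

M. Aizenman, H. Duminil-Copin, Ann. of Math. **194** (2021) = arXiv:1912.07973, §6.2, proof of Lemma 6.7
(p. 25). `SplitFailureBound.splitFail_hG` bounds the split-event error `ε_G` of the mixing core by current sums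
over spheres of the finite graph. On the induced graph of a finite `Λ ⊆ ℤ⁴` with constant couplings `β ≥ 0`
these are finite-volume two-point functions `⟨σ_aσ_b⟩_Λ ≤ S_β(b-a)` (`MixingBoxConcentration.boxTwoPt_le`),
so that the printed estimates apply: the Infrared Bound for the numerators (`CrossingNumerics`), a lower
bound on the two-point function for the denominator of (6.11), and the domination
`⟨σ_vσ_{y}⟩ ≤ θ⟨σ_{u}σ_{y}⟩` of the sets `𝔸_y` for the inward chain rule. This file performs that
translation:

* `sum_distEq_le_sum_sphere` — sphere sums on the graph are dominated by lattice sphere sums;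
* `offSum_le`, `chainOut_mul_le`, `chainIn_mul_le` — the four kinds of sphere sums of `splitFail_hG` bounded
  by `Z`-multiples of explicit reals;
* `Current.splitFail_hG_real` — **`hG` with `ε_G ≤ ENNReal.ofReal E`**, `E` the printed sum of
  `C R³M³/R⁴`-, `C R³N³/N⁴`-, `C r³/m²`-type terms (as explicit functions of the radii, the infrared constant,
  the lower bound `s_W` of `S` on the switch blocks, the domination factor `θ` and the comparison loss `η`).

## References

* M. Aizenman, H. Duminil-Copin, Ann. of Math. 194 (2021), arXiv:1912.07973, §6.2, proof of Lemma 6.7,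
  (6.11)–(6.12) (p. 25) [AizenmanDuminilCopinAnnals2021].
-/

noncomputable section

open Finset Filter
open scoped symmDiff ENNReal

namespace Literature.Probability.LatticeModels

variable {Λ : Finset (Site 4)} {β : ℝ}

/-! ### Graph spheres versus lattice spheres -/

/-- The distance on `↥Λ` is the sup norm of the difference. [folklore] -/
theorem dist_coe_eq_supNorm (a b : ↥Λ) : dist a b = (Site.supNorm ((b : Site 4) - (a : Site 4)) : ℝ) := by
  rw [Subtype.dist_eq, Site.dist_eq_supNorm, Site.supNorm_sub_comm]

/-- **Sphere sums on the graph are dominated by lattice sphere sums** (non-negative summands):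
`∑_{u ∈ Λ : dist(w,u) = ρ} f(u - w) ≤ ∑_{p ∈ ∂Λ_ρ} f(p)`. [folklore] -/
theorem sum_distEq_le_sum_sphere (w : ↥Λ) (ρ : ℕ) {f : Site 4 → ℝ} (hf : ∀ p, 0 ≤ f p) :
    ∑ u ∈ univ.filter (fun u : ↥Λ => dist w u = ρ), f ((u : Site 4) - (w : Site 4)) ≤ ∑ p ∈ sphere 4 ρ, f p := by
  classical
  rw [← Finset.sum_image (f := f) (s := univ.filter (fun u : ↥Λ => dist w u = ρ)) (g := fun u => (u : Site 4) - w)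
    (fun a _ b _ h => Subtype.ext (sub_left_injective h))]
  refine Finset.sum_le_sum_of_subset_of_nonneg (fun p hp => ?_) (fun p _ _ => hf p)
  rw [Finset.mem_image] at hp
  obtain ⟨u, hu, rfl⟩ := hp
  rw [mem_filter, dist_coe_eq_supNorm] at hu
  rw [mem_sphere]
  exact_mod_cast hu.2

/-- Double sphere sums likewise. [folklore] -/
theorem sum_sum_distEq_le_sum_sphere (w : ↥Λ) (a b : ℕ) {f : Site 4 → ℝ} (hf : ∀ p, 0 ≤ f p) :
    ∑ s ∈ univ.filter (fun s : ↥Λ => dist w s = a), ∑ z ∈ univ.filter (fun z : ↥Λ => dist w z = b),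
        f ((z : Site 4) - (s : Site 4)) ≤ ∑ s ∈ sphere 4 a, ∑ z ∈ sphere 4 b, f (z - s) := by
  calc ∑ s ∈ univ.filter (fun s : ↥Λ => dist w s = a), ∑ z ∈ univ.filter (fun z : ↥Λ => dist w z = b), f ((z : Site 4) - (s : Site 4))
      = ∑ s ∈ univ.filter (fun s : ↥Λ => dist w s = a), ∑ z ∈ univ.filter (fun z : ↥Λ => dist w z = b),
          f (((z : Site 4) - (w : Site 4)) - ((s : Site 4) - (w : Site 4))) := by
        refine Finset.sum_congr rfl fun s _ => Finset.sum_congr rfl fun z _ => ?_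
        congr 1; abel
    _ ≤ ∑ s ∈ univ.filter (fun s : ↥Λ => dist w s = a), ∑ z ∈ sphere 4 b, f (z - ((s : Site 4) - (w : Site 4))) :=
        Finset.sum_le_sum fun s _ => sum_distEq_le_sum_sphere w b (f := fun p => f (p - ((s : Site 4) - (w : Site 4)))) fun p => hf _
    _ = ∑ z ∈ sphere 4 b, ∑ s ∈ univ.filter (fun s : ↥Λ => dist w s = a), f (z - ((s : Site 4) - (w : Site 4))) := Finset.sum_comm
    _ ≤ ∑ z ∈ sphere 4 b, ∑ s ∈ sphere 4 a, f (z - s) :=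
        Finset.sum_le_sum fun z _ => sum_distEq_le_sum_sphere w a (f := fun p => f (z - p)) fun p => hf _
    _ = _ := Finset.sum_comm

/-! ### The sphere sums of `splitFail_hG` through `S` -/

section Pieces

variable (hβ : 0 ≤ β) {CIR : ℝ} (hS0 : ∀ x, 0 ≤ twoPointFree 4 β x)
  (hIR : ∀ x : Site 4, x ≠ 0 → twoPointFree 4 β x ≤ CIR / (Site.supNorm x : ℝ) ^ 2) (hC : 0 ≤ CIR)

include hβ hS0 hIR hC

/-- **The off-part sums**: `∑_{dist=a}∑_{dist=b} Z[sz]² ≤ ofReal(216a³·216b³(C_IR/(b-a)²)²) · Z[∅]²` (`1 ≤ a < b`).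
[cite: AizenmanDuminilCopinAnnals2021, arXiv:1912.07973 §6.2, proof of Lemma 6.7, (6.12) (p. 25)] -/
theorem offSum_le (w : ↥Λ) {a b : ℕ} (ha : 1 ≤ a) (hab : a < b) :
    ∑ s ∈ univ.filter (fun s : ↥Λ => dist w s = a), ∑ z ∈ univ.filter (fun z : ↥Λ => dist w z = b),
        ecurrentSum (Kc Λ β) ({s} ∆ {z}) ^ 2 ≤
      ENNReal.ofReal ((216 * (a : ℝ) ^ 3) * (216 * (b : ℝ) ^ 3) * (CIR / ((b - a : ℕ) : ℝ) ^ 2) ^ 2) *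
        ecurrentSum (Kc Λ β) ∅ ^ 2 := by
  have hK : ∀ e, 0 ≤ Kc Λ β e := fun _ => hβ
  set z0 : ℝ := (ecurrentSum (Kc Λ β) ∅).toReal with hz0
  have hZ0 : ecurrentSum (Kc Λ β) ∅ = ENNReal.ofReal z0 := (ENNReal.ofReal_toReal (ecurrentSum_ne_top hK _)).symm
  have hz0nn : 0 ≤ z0 := ENNReal.toReal_nonneg
  have hTnn : ∀ a b : ↥Λ, 0 ≤ boxTwoPt Λ β a b := fun a b => by
    rw [boxTwoPt_eq_div hβ]; exact div_nonneg ENNReal.toReal_nonneg ENNReal.toReal_nonneg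
  have hZ : ∀ a b : ↥Λ, ecurrentSum (Kc Λ β) ({a} ∆ {b}) = ENNReal.ofReal (boxTwoPt Λ β a b * z0) := fun a b => by
    rw [← toReal_ecurrentSum_pair hβ, ENNReal.ofReal_toReal (ecurrentSum_ne_top hK _)]
  have hterm : ∀ s z : ↥Λ, ecurrentSum (Kc Λ β) ({s} ∆ {z}) ^ 2 = ENNReal.ofReal (z0 ^ 2 * boxTwoPt Λ β s z ^ 2) := by
    intro s z
    rw [hZ, ← ENNReal.ofReal_pow (mul_nonneg (hTnn s z) hz0nn)]
    congr 1; ring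
  simp_rw [hterm]
  rw [hZ0, ← ENNReal.ofReal_pow hz0nn, ← ENNReal.ofReal_mul (by positivity)]
  have hinner : ∀ s : ↥Λ, ∑ z ∈ univ.filter (fun z : ↥Λ => dist w z = b), ENNReal.ofReal (z0 ^ 2 * boxTwoPt Λ β s z ^ 2) =
      ENNReal.ofReal (∑ z ∈ univ.filter (fun z : ↥Λ => dist w z = b), z0 ^ 2 * boxTwoPt Λ β s z ^ 2) := fun s =>
    (ENNReal.ofReal_sum_of_nonneg fun z _ => by have := hTnn s z; positivity).symm
  simp_rw [hinner]
  rw [← ENNReal.ofReal_sum_of_nonneg (fun s _ => Finset.sum_nonneg fun z _ => by have := hTnn s z; positivity)]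
  refine ENNReal.ofReal_le_ofReal ?_
  simp_rw [← Finset.mul_sum]
  rw [mul_comm]
  refine mul_le_mul_of_nonneg_right ?_ (by positivity)
  calc ∑ s ∈ univ.filter (fun s : ↥Λ => dist w s = a), ∑ z ∈ univ.filter (fun z : ↥Λ => dist w z = b), boxTwoPt Λ β s z ^ 2
      ≤ ∑ s ∈ univ.filter (fun s : ↥Λ => dist w s = a), ∑ z ∈ univ.filter (fun z : ↥Λ => dist w z = b),
          twoPointFree 4 β ((z : Site 4) - (s : Site 4)) ^ 2 :=
        Finset.sum_le_sum fun s _ => Finset.sum_le_sum fun z _ => pow_le_pow_left₀ (hTnn s z) (boxTwoPt_le hβ s z) 2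
    _ ≤ ∑ s ∈ sphere 4 a, ∑ z ∈ sphere 4 b, twoPointFree 4 β (z - s) ^ 2 :=
        sum_sum_distEq_le_sum_sphere w a b (f := fun p => twoPointFree 4 β p ^ 2) fun p => by positivity
    _ ≤ _ := sum_sphere_sphere_sq_le hS0 hIR hC ha hab

/-- **The outward chain-rule sum**: for `‖v - w‖ ≤ M₃ < R` and `⟨σ_wσ_v⟩_Λ ≥ (1-η) S(v-w) ≥ (1-η) s_W > 0`,
`(∑_{dist(w,u)=R} Z[wu]Z[uv]) Z[∅] ≤ ofReal(216R³(C_IR/R²)(C_IR/(R-M₃)²)/((1-η)s_W)) · Z[wv] Z[∅]²` — the numerator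
by the Infrared Bound, the denominator by the lower bound on the two-point function.
[cite: AizenmanDuminilCopinAnnals2021, arXiv:1912.07973 §6.2, proof of Lemma 6.7, (6.11) (p. 25)] -/
theorem chainOut_mul_le (w v : ↥Λ) {M₃ R : ℕ} (hvM : Site.supNorm ((v : Site 4) - (w : Site 4)) ≤ M₃) (hMR : M₃ < R)
    {η sW : ℝ} (hη1 : η < 1) (hsW : 0 < sW) (hSv : sW ≤ twoPointFree 4 β ((v : Site 4) - (w : Site 4)))
    (hlow : (1 - η) * twoPointFree 4 β ((v : Site 4) - (w : Site 4)) ≤ boxTwoPt Λ β w v) :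
    (∑ u ∈ univ.filter (fun u : ↥Λ => dist w u = R), ecurrentSum (Kc Λ β) ({w} ∆ {u}) * ecurrentSum (Kc Λ β) ({u} ∆ {v})) *
        ecurrentSum (Kc Λ β) ∅ ≤
      ENNReal.ofReal ((216 * (R : ℝ) ^ 3) * ((CIR / (R : ℝ) ^ 2) * (CIR / ((R - M₃ : ℕ) : ℝ) ^ 2)) / ((1 - η) * sW)) *
        (ecurrentSum (Kc Λ β) ({w} ∆ {v}) * ecurrentSum (Kc Λ β) ∅ ^ 2) := by
  have hK : ∀ e, 0 ≤ Kc Λ β e := fun _ => hβ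
  have h1η : 0 < 1 - η := by linarith
  set z0 : ℝ := (ecurrentSum (Kc Λ β) ∅).toReal with hz0
  have hZ0 : ecurrentSum (Kc Λ β) ∅ = ENNReal.ofReal z0 := (ENNReal.ofReal_toReal (ecurrentSum_ne_top hK _)).symm
  have hz0nn : 0 ≤ z0 := ENNReal.toReal_nonneg
  have hTnn : ∀ a b : ↥Λ, 0 ≤ boxTwoPt Λ β a b := fun a b => by
    rw [boxTwoPt_eq_div hβ]; exact div_nonneg ENNReal.toReal_nonneg ENNReal.toReal_nonneg
  have hZ : ∀ a b : ↥Λ, ecurrentSum (Kc Λ β) ({a} ∆ {b}) = ENNReal.ofReal (boxTwoPt Λ β a b * z0) := fun a b => by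
    rw [← toReal_ecurrentSum_pair hβ, ENNReal.ofReal_toReal (ecurrentSum_ne_top hK _)]
  set e : ℝ := (216 * (R : ℝ) ^ 3) * ((CIR / (R : ℝ) ^ 2) * (CIR / ((R - M₃ : ℕ) : ℝ) ^ 2)) with he
  have he0 : 0 ≤ e := by rw [he]; positivity
  -- everything as `ofReal`
  have hterm : ∀ u : ↥Λ, ecurrentSum (Kc Λ β) ({w} ∆ {u}) * ecurrentSum (Kc Λ β) ({u} ∆ {v}) =
      ENNReal.ofReal (z0 ^ 2 * (boxTwoPt Λ β w u * boxTwoPt Λ β u v)) := by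
    intro u
    rw [hZ, hZ, ← ENNReal.ofReal_mul (mul_nonneg (hTnn w u) hz0nn)]
    congr 1; ring
  simp_rw [hterm]
  rw [← ENNReal.ofReal_sum_of_nonneg (fun u _ => by have := hTnn w u; have := hTnn u v; positivity), hZ0, hZ,
    ← ENNReal.ofReal_pow hz0nn, ← ENNReal.ofReal_mul (Finset.sum_nonneg fun u _ => by
      have := hTnn w u; have := hTnn u v; positivity),
    ← ENNReal.ofReal_mul (mul_nonneg (hTnn w v) hz0nn), ← ENNReal.ofReal_mul (div_nonneg he0 (by positivity))]
  refine ENNReal.ofReal_le_ofReal ?_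
  rw [← Finset.mul_sum]
  -- the real inequality `z0² (Σ T T) z0 ≤ e/((1-η)sW) · (T(w,v) z0 · z0²)`
  have hsum : ∑ u ∈ univ.filter (fun u : ↥Λ => dist w u = R), boxTwoPt Λ β w u * boxTwoPt Λ β u v ≤ e := by
    calc ∑ u ∈ univ.filter (fun u : ↥Λ => dist w u = R), boxTwoPt Λ β w u * boxTwoPt Λ β u v
        ≤ ∑ u ∈ univ.filter (fun u : ↥Λ => dist w u = R),
            twoPointFree 4 β ((u : Site 4) - (w : Site 4)) * twoPointFree 4 β (((v : Site 4) - (w : Site 4)) - ((u : Site 4) - (w : Site 4))) := by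
          refine Finset.sum_le_sum fun u _ => mul_le_mul (boxTwoPt_le hβ w u) ?_ (hTnn u v) (hS0 _)
          rw [show (v : Site 4) - w - ((u : Site 4) - (w : Site 4)) = (v : Site 4) - u by abel]
          exact boxTwoPt_le hβ u v
      _ ≤ ∑ p ∈ sphere 4 R, twoPointFree 4 β p * twoPointFree 4 β (((v : Site 4) - (w : Site 4)) - p) :=
          sum_distEq_le_sum_sphere w R (f := fun p => twoPointFree 4 β p * twoPointFree 4 β (((v : Site 4) - (w : Site 4)) - p))
            fun p => mul_nonneg (hS0 _) (hS0 _)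
      _ ≤ (216 * (R : ℝ) ^ 3) * ((CIR / (R : ℝ) ^ 2) * (CIR / ((R - Site.supNorm ((v : Site 4) - (w : Site 4)) : ℕ) : ℝ) ^ 2)) :=
          sum_sphere_mul_le hS0 hIR hC (by omega)
      _ ≤ e := by
          rw [he]
          have hRM : (1 : ℝ) ≤ ((R - M₃ : ℕ) : ℝ) := by exact_mod_cast (show 1 ≤ R - M₃ by omega)
          have hle : ((R - M₃ : ℕ) : ℝ) ≤ ((R - Site.supNorm ((v : Site 4) - (w : Site 4)) : ℕ) : ℝ) := by
            exact_mod_cast (show R - M₃ ≤ R - Site.supNorm ((v : Site 4) - (w : Site 4)) by omega)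
          gcongr
  have hden : sW ≤ boxTwoPt Λ β w v / (1 - η) := by
    rw [le_div_iff₀ h1η]; nlinarith
  calc z0 ^ 2 * (∑ u ∈ univ.filter (fun u : ↥Λ => dist w u = R), boxTwoPt Λ β w u * boxTwoPt Λ β u v) * z0
      ≤ z0 ^ 2 * e * z0 := by gcongr
    _ = e / ((1 - η) * sW) * ((1 - η) * sW) * z0 * z0 ^ 2 := by field_simp
    _ ≤ e / ((1 - η) * sW) * ((1 - η) * (boxTwoPt Λ β w v / (1 - η))) * z0 * z0 ^ 2 := by gcongr
    _ = e / ((1 - η) * sW) * (boxTwoPt Λ β w v * z0 * z0 ^ 2) := by field_simp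

/-- **The inward chain-rule sum**: for `m_ℓ ≤ ‖v - w‖`, `1 ≤ r < m_ℓ`, the domination
`S(y - w - p) ≤ θ S(y - v)` for `‖p‖ ≤ r` (the defining inequality of `𝔸_y`) and `⟨σ_vσ_y⟩_Λ ≥ (1-η) S(y-v)`:
`(∑_{dist(w,u)=r} Z[vu]Z[uy]) Z[∅] ≤ ofReal(θ·216r³·C_IR/((1-η)(m_ℓ-r)²)) · Z[vy] Z[∅]²`.
[cite: AizenmanDuminilCopinAnnals2021, arXiv:1912.07973 §6.2, proof of Lemma 6.7, last display (p. 25)] -/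
theorem chainIn_mul_le (w v y : ↥Λ) {r mℓ : ℕ} (hr : 1 ≤ r) (hrm : r < mℓ) (hvm : mℓ ≤ Site.supNorm ((v : Site 4) - (w : Site 4)))
    {η θ : ℝ} (hη1 : η < 1) (hθ : 0 ≤ θ)
    (hdom : ∀ p : Site 4, Site.supNorm p ≤ r → twoPointFree 4 β ((y : Site 4) - w - p) ≤ θ * twoPointFree 4 β ((y : Site 4) - (v : Site 4)))
    (hlow : (1 - η) * twoPointFree 4 β ((y : Site 4) - (v : Site 4)) ≤ boxTwoPt Λ β v y) :
    (∑ u ∈ univ.filter (fun u : ↥Λ => dist w u = r), ecurrentSum (Kc Λ β) ({v} ∆ {u}) * ecurrentSum (Kc Λ β) ({u} ∆ {y})) *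
        ecurrentSum (Kc Λ β) ∅ ≤
      ENNReal.ofReal (θ * (216 * (r : ℝ) ^ 3) * (CIR / ((mℓ - r : ℕ) : ℝ) ^ 2) / (1 - η)) *
        (ecurrentSum (Kc Λ β) ({v} ∆ {y}) * ecurrentSum (Kc Λ β) ∅ ^ 2) := by
  have hK : ∀ e, 0 ≤ Kc Λ β e := fun _ => hβ
  have h1η : 0 < 1 - η := by linarith
  set z0 : ℝ := (ecurrentSum (Kc Λ β) ∅).toReal with hz0
  have hZ0 : ecurrentSum (Kc Λ β) ∅ = ENNReal.ofReal z0 := (ENNReal.ofReal_toReal (ecurrentSum_ne_top hK _)).symm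
  have hz0nn : 0 ≤ z0 := ENNReal.toReal_nonneg
  have hTnn : ∀ a b : ↥Λ, 0 ≤ boxTwoPt Λ β a b := fun a b => by
    rw [boxTwoPt_eq_div hβ]; exact div_nonneg ENNReal.toReal_nonneg ENNReal.toReal_nonneg
  have hZ : ∀ a b : ↥Λ, ecurrentSum (Kc Λ β) ({a} ∆ {b}) = ENNReal.ofReal (boxTwoPt Λ β a b * z0) := fun a b => by
    rw [← toReal_ecurrentSum_pair hβ, ENNReal.ofReal_toReal (ecurrentSum_ne_top hK _)]
  set e : ℝ := θ * (216 * (r : ℝ) ^ 3) * (CIR / ((mℓ - r : ℕ) : ℝ) ^ 2) with he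
  have he0 : 0 ≤ e := by rw [he]; positivity
  have hterm : ∀ u : ↥Λ, ecurrentSum (Kc Λ β) ({v} ∆ {u}) * ecurrentSum (Kc Λ β) ({u} ∆ {y}) =
      ENNReal.ofReal (z0 ^ 2 * (boxTwoPt Λ β v u * boxTwoPt Λ β u y)) := by
    intro u
    rw [hZ, hZ, ← ENNReal.ofReal_mul (mul_nonneg (hTnn v u) hz0nn)]
    congr 1; ring
  simp_rw [hterm]
  rw [← ENNReal.ofReal_sum_of_nonneg (fun u _ => by have := hTnn v u; have := hTnn u y; positivity), hZ0, hZ,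
    ← ENNReal.ofReal_pow hz0nn, ← ENNReal.ofReal_mul (Finset.sum_nonneg fun u _ => by
      have := hTnn v u; have := hTnn u y; positivity),
    ← ENNReal.ofReal_mul (mul_nonneg (hTnn v y) hz0nn), ← ENNReal.ofReal_mul (div_nonneg he0 h1η.le)]
  refine ENNReal.ofReal_le_ofReal ?_
  rw [← Finset.mul_sum]
  have hSyv : 0 ≤ twoPointFree 4 β ((y : Site 4) - (v : Site 4)) := hS0 _
  -- `Σ T(v,u)T(u,y) ≤ θ S(y-v) Σ_{sphere r} S(p-(v-w)) ≤ θ S(y-v) 216r³ C/(‖v-w‖-r)² ≤ e S(y-v)`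
  have hsum : ∑ u ∈ univ.filter (fun u : ↥Λ => dist w u = r), boxTwoPt Λ β v u * boxTwoPt Λ β u y ≤
      e * twoPointFree 4 β ((y : Site 4) - (v : Site 4)) := by
    calc ∑ u ∈ univ.filter (fun u : ↥Λ => dist w u = r), boxTwoPt Λ β v u * boxTwoPt Λ β u y
        ≤ ∑ u ∈ univ.filter (fun u : ↥Λ => dist w u = r),
            twoPointFree 4 β (((u : Site 4) - (w : Site 4)) - ((v : Site 4) - (w : Site 4))) * (θ * twoPointFree 4 β ((y : Site 4) - (v : Site 4))) := by
          refine Finset.sum_le_sum fun u hu => mul_le_mul ?_ ?_ (hTnn u y) (hS0 _)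
          · rw [show (u : Site 4) - w - ((v : Site 4) - (w : Site 4)) = (u : Site 4) - v by abel]; exact boxTwoPt_le hβ v u
          · refine (boxTwoPt_le hβ u y).trans ?_
            rw [show (y : Site 4) - u = (y : Site 4) - w - ((u : Site 4) - (w : Site 4)) by abel]
            refine hdom _ ?_
            rw [mem_filter, dist_coe_eq_supNorm] at hu
            exact_mod_cast hu.2.le
      _ = (θ * twoPointFree 4 β ((y : Site 4) - (v : Site 4))) *
            ∑ u ∈ univ.filter (fun u : ↥Λ => dist w u = r), twoPointFree 4 β (((u : Site 4) - (w : Site 4)) - ((v : Site 4) - (w : Site 4))) := by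
          rw [Finset.mul_sum]; refine Finset.sum_congr rfl fun u _ => ?_; ring
      _ ≤ (θ * twoPointFree 4 β ((y : Site 4) - (v : Site 4))) * ∑ p ∈ sphere 4 r, twoPointFree 4 β (p - ((v : Site 4) - (w : Site 4))) :=
          mul_le_mul_of_nonneg_left (sum_distEq_le_sum_sphere w r (f := fun p => twoPointFree 4 β (p - ((v : Site 4) - (w : Site 4))))
            fun p => hS0 _) (mul_nonneg hθ hSyv)
      _ ≤ (θ * twoPointFree 4 β ((y : Site 4) - (v : Site 4))) *
            ((216 * (r : ℝ) ^ 3) * (CIR / ((Site.supNorm ((v : Site 4) - (w : Site 4)) - r : ℕ) : ℝ) ^ 2)) :=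
          mul_le_mul_of_nonneg_left (sum_sphere_shift_le hIR hC hr (by omega)) (mul_nonneg hθ hSyv)
      _ ≤ (θ * twoPointFree 4 β ((y : Site 4) - (v : Site 4))) * ((216 * (r : ℝ) ^ 3) * (CIR / ((mℓ - r : ℕ) : ℝ) ^ 2)) := by
          have h1 : (1 : ℝ) ≤ ((mℓ - r : ℕ) : ℝ) := by exact_mod_cast (show 1 ≤ mℓ - r by omega)
          have hle : ((mℓ - r : ℕ) : ℝ) ≤ ((Site.supNorm ((v : Site 4) - (w : Site 4)) - r : ℕ) : ℝ) := by
            exact_mod_cast (show mℓ - r ≤ Site.supNorm ((v : Site 4) - (w : Site 4)) - r by omega)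
          have := mul_nonneg hθ hSyv
          gcongr
      _ = e * twoPointFree 4 β ((y : Site 4) - (v : Site 4)) := by rw [he]; ring
  have hden : twoPointFree 4 β ((y : Site 4) - (v : Site 4)) ≤ boxTwoPt Λ β v y / (1 - η) := by
    rw [le_div_iff₀ h1η]; nlinarith
  calc z0 ^ 2 * (∑ u ∈ univ.filter (fun u : ↥Λ => dist w u = r), boxTwoPt Λ β v u * boxTwoPt Λ β u y) * z0
      ≤ z0 ^ 2 * (e * twoPointFree 4 β ((y : Site 4) - (v : Site 4))) * z0 := by gcongr
    _ ≤ z0 ^ 2 * (e * (boxTwoPt Λ β v y / (1 - η))) * z0 := by gcongr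
    _ = e / (1 - η) * (boxTwoPt Λ β v y * z0 * z0 ^ 2) := by field_simp

/-- The off-part sums with the outer sphere first (`a > b ≥ 1`). [cite: AizenmanDuminilCopinAnnals2021, arXiv:1912.07973 §6.2, proof of Lemma 6.7, (6.12) (p. 25)] -/
theorem offSum_le' (w : ↥Λ) {a b : ℕ} (hb : 1 ≤ b) (hba : b < a) :
    ∑ s ∈ univ.filter (fun s : ↥Λ => dist w s = a), ∑ z ∈ univ.filter (fun z : ↥Λ => dist w z = b),
        ecurrentSum (Kc Λ β) ({s} ∆ {z}) ^ 2 ≤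
      ENNReal.ofReal ((216 * (b : ℝ) ^ 3) * (216 * (a : ℝ) ^ 3) * (CIR / ((a - b : ℕ) : ℝ) ^ 2) ^ 2) *
        ecurrentSum (Kc Λ β) ∅ ^ 2 := by
  rw [Finset.sum_comm]
  have h : ∀ z s : ↥Λ, ecurrentSum (Kc Λ β) ({s} ∆ {z}) = ecurrentSum (Kc Λ β) ({z} ∆ {s}) := fun z s => by
    rw [symmDiff_comm]
  simp_rw [h]
  exact offSum_le hβ hS0 hIR hC w hb hba

end Pieces

/-! ### `hG` through `S` -/

namespace Current
set_option maxHeartbeats 400000 in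
open Classical in
/-- **Lemma 6.7 in a finite volume of `ℤ⁴`, with the printed right-hand side.** For `β ≥ 0`, `S = S_β ≥ 0` obeying
the infrared-type bound `S(x) ≤ C_IR/‖x‖²`, radii `1 ≤ n₀ < r < m_ℓ`, `r ≤ m₀+1`, `n₀ ≤ m₀ ≤ M₃ < R ≤ N₄`, switch
points `vᵢ` with `m_ℓ ≤ ‖vᵢ-w‖ ≤ M₃` and `S(vᵢ-w) ≥ s_W > 0`, far sources with `dist(w,yᵢ) > N₄`, the
domination `S(yᵢ-w-p) ≤ θ S(yᵢ-vᵢ)` (`‖p‖ ≤ r`), the comparison `(1-η)S ≤ ⟨·⟩_Λ` on the pairs `(w,vᵢ)`, `(vᵢ,yᵢ)`,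
non-vanishing pair masses, `E_in` inside `Λ_{n₀}(w)` and `E_out` meeting `Λ_{N₄}(w)ᶜ`:
`∑_ω W_sw 𝟙[G(v)ᶜ] ≤ ofReal(E) ∑_ω W_sw`, with
`E = 2(e_off(M₃,N₄+1) + e_off(n₀,m₀+1)) + 2(e_out + e_off(R,N₄+1) + e_in + e_off(n₀,r))`,
`e_off(a,b) = 216a³·216b³(C_IR/(b-a)²)²`, `e_out = 216R³(C_IR/R²)(C_IR/(R-M₃)²)/((1-η)s_W)`,
`e_in = θ·216r³(C_IR/(m_ℓ-r)²)/(1-η)` — "`≤ C₂R³M³/R⁴`", "`≤ C₃R³N³(R/N)⁴`", "`≤ C₅r³/m²`".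
[cite: AizenmanDuminilCopinAnnals2021, arXiv:1912.07973 §6.2, Lemma 6.7 and its proof, (6.11)–(6.12) (pp. 24–25)] -/
theorem splitFail_hG_real (hβ : 0 ≤ β) {CIR : ℝ} (hS0 : ∀ x, 0 ≤ twoPointFree 4 β x)
    (hIR : ∀ x : Site 4, x ≠ 0 → twoPointFree 4 β x ≤ CIR / (Site.supNorm x : ℝ) ^ 2) (hC : 0 ≤ CIR)
    {rk : (boxGraph Λ).edgeFinset → ℕ} (hrk : Function.Injective rk) (w : ↥Λ)
    {n₀ r mℓ m₀ M₃ R N₄ : ℕ} (hn₀ : 1 ≤ n₀) (hn₀r : n₀ < r) (hrmℓ : r < mℓ) (hrm : r ≤ m₀ + 1) (h12 : n₀ ≤ m₀)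
    (h23 : m₀ ≤ M₃) (hMR : M₃ < R) (hRN : R ≤ N₄) {v₁ v₂ y₁ y₂ : ↥Λ}
    (hv₁ℓ : mℓ ≤ Site.supNorm ((v₁ : Site 4) - (w : Site 4))) (hv₁M : Site.supNorm ((v₁ : Site 4) - (w : Site 4)) ≤ M₃)
    (hv₂ℓ : mℓ ≤ Site.supNorm ((v₂ : Site 4) - (w : Site 4))) (hv₂M : Site.supNorm ((v₂ : Site 4) - (w : Site 4)) ≤ M₃)
    (hy₁ : (N₄ : ℝ) < dist w y₁) (hy₂ : (N₄ : ℝ) < dist w y₂)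
    {η sW θ : ℝ} (hη1 : η < 1) (hsW : 0 < sW) (hθ : 0 ≤ θ)
    (hSv₁ : sW ≤ twoPointFree 4 β ((v₁ : Site 4) - (w : Site 4))) (hSv₂ : sW ≤ twoPointFree 4 β ((v₂ : Site 4) - (w : Site 4)))
    (hdom₁ : ∀ p : Site 4, Site.supNorm p ≤ r →
      twoPointFree 4 β ((y₁ : Site 4) - (w : Site 4) - p) ≤ θ * twoPointFree 4 β ((y₁ : Site 4) - (v₁ : Site 4)))
    (hdom₂ : ∀ p : Site 4, Site.supNorm p ≤ r →
      twoPointFree 4 β ((y₂ : Site 4) - (w : Site 4) - p) ≤ θ * twoPointFree 4 β ((y₂ : Site 4) - (v₂ : Site 4)))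
    (hlow_wv₁ : (1 - η) * twoPointFree 4 β ((v₁ : Site 4) - (w : Site 4)) ≤ boxTwoPt Λ β w v₁)
    (hlow_wv₂ : (1 - η) * twoPointFree 4 β ((v₂ : Site 4) - (w : Site 4)) ≤ boxTwoPt Λ β w v₂)
    (hlow_vy₁ : (1 - η) * twoPointFree 4 β ((y₁ : Site 4) - (v₁ : Site 4)) ≤ boxTwoPt Λ β v₁ y₁)
    (hlow_vy₂ : (1 - η) * twoPointFree 4 β ((y₂ : Site 4) - (v₂ : Site 4)) ≤ boxTwoPt Λ β v₂ y₂)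
    (hZ₁ : ecurrentSum (Kc Λ β) ({w} ∆ {v₁}) * ecurrentSum (Kc Λ β) ({v₁} ∆ {y₁}) ≠ 0)
    (hZ₂ : ecurrentSum (Kc Λ β) ({w} ∆ {v₂}) * ecurrentSum (Kc Λ β) ({v₂} ∆ {y₂}) ≠ 0)
    {Ein Eout : Finset (boxGraph Λ).edgeFinset}
    (hEin : ∀ e ∈ Ein, ∀ z ∈ (e : Sym2 ↥Λ), dist w z ≤ n₀)
    (hEout : ∀ e ∈ Eout, ∃ z ∈ (e : Sym2 ↥Λ), (N₄ : ℝ) < dist w z) :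
    ∑' ω : OctoCfg (boxGraph Λ), octoWeightSw (Kc Λ β) w w w y₁ y₂ v₁ v₂ ω *
        splitFailInd Ein Eout (octoU w v₁ v₂) (octoY w y₁ y₂) ω ≤
      ENNReal.ofReal (2 * ((216 * (M₃ : ℝ) ^ 3) * (216 * ((N₄ + 1 : ℕ) : ℝ) ^ 3) * (CIR / ((N₄ + 1 - M₃ : ℕ) : ℝ) ^ 2) ^ 2 +
            (216 * (n₀ : ℝ) ^ 3) * (216 * ((m₀ + 1 : ℕ) : ℝ) ^ 3) * (CIR / ((m₀ + 1 - n₀ : ℕ) : ℝ) ^ 2) ^ 2) +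
          2 * ((216 * (R : ℝ) ^ 3) * ((CIR / (R : ℝ) ^ 2) * (CIR / ((R - M₃ : ℕ) : ℝ) ^ 2)) / ((1 - η) * sW) +
            (216 * (R : ℝ) ^ 3) * (216 * ((N₄ + 1 : ℕ) : ℝ) ^ 3) * (CIR / ((N₄ + 1 - R : ℕ) : ℝ) ^ 2) ^ 2 +
            θ * (216 * (r : ℝ) ^ 3) * (CIR / ((mℓ - r : ℕ) : ℝ) ^ 2) / (1 - η) +
            (216 * (n₀ : ℝ) ^ 3) * (216 * (r : ℝ) ^ 3) * (CIR / ((r - n₀ : ℕ) : ℝ) ^ 2) ^ 2)) *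
        ∑' ω : OctoCfg (boxGraph Λ), octoWeightSw (Kc Λ β) w w w y₁ y₂ v₁ v₂ ω := by
  have hK : ∀ e, 0 ≤ Kc Λ β e := fun _ => hβ
  have h1η : 0 < 1 - η := by linarith
  have hZtop : ∀ A, ecurrentSum (Kc Λ β) A ≠ ∞ := fun A => ecurrentSum_ne_top hK A
  have hZ0 : ecurrentSum (Kc Λ β) (∅ : Finset ↥Λ) ≠ 0 := ecurrentSum_empty_ne_zero _
  have hQ0 : ecurrentSum (Kc Λ β) (∅ : Finset ↥Λ) ^ 2 ≠ 0 := pow_ne_zero 2 hZ0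
  have hQt : ecurrentSum (Kc Λ β) (∅ : Finset ↥Λ) ^ 2 ≠ ∞ := ENNReal.pow_ne_top (hZtop ∅)
  -- distances of the switch points
  have hdv : ∀ {v : ↥Λ}, mℓ ≤ Site.supNorm ((v : Site 4) - (w : Site 4)) → Site.supNorm ((v : Site 4) - (w : Site 4)) ≤ M₃ →
      (r : ℝ) < dist w v ∧ dist w v ≤ M₃ := fun {v} h1 h2 => by
    rw [dist_coe_eq_supNorm]; exact ⟨by exact_mod_cast (show r < _ by omega), by exact_mod_cast h2⟩
  obtain ⟨hrv₁, hv₁M'⟩ := hdv hv₁ℓ hv₁M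
  obtain ⟨hrv₂, hv₂M'⟩ := hdv hv₂ℓ hv₂M
  have hG := splitFail_hG hK hrk (boxGraph_dist_step w) (boxGraph_dist_natCast w) hn₀r.le hrm h12 h23 (by omega) hMR
    (by omega) hrv₁ hv₁M' hrv₂ hv₂M' hy₁ hy₂ hZ₁ hZ₂ hEin hEout
  refine hG.trans (mul_le_mul' ?_ le_rfl)
  -- the explicit reals
  set eO : ℝ := (216 * (M₃ : ℝ) ^ 3) * (216 * ((N₄ + 1 : ℕ) : ℝ) ^ 3) * (CIR / ((N₄ + 1 - M₃ : ℕ) : ℝ) ^ 2) ^ 2 with heO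
  set eI : ℝ := (216 * (n₀ : ℝ) ^ 3) * (216 * ((m₀ + 1 : ℕ) : ℝ) ^ 3) * (CIR / ((m₀ + 1 - n₀ : ℕ) : ℝ) ^ 2) ^ 2 with heI
  set eout : ℝ := (216 * (R : ℝ) ^ 3) * ((CIR / (R : ℝ) ^ 2) * (CIR / ((R - M₃ : ℕ) : ℝ) ^ 2)) / ((1 - η) * sW) with heout
  set eoffR : ℝ := (216 * (R : ℝ) ^ 3) * (216 * ((N₄ + 1 : ℕ) : ℝ) ^ 3) * (CIR / ((N₄ + 1 - R : ℕ) : ℝ) ^ 2) ^ 2 with heoffR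
  set ein : ℝ := θ * (216 * (r : ℝ) ^ 3) * (CIR / ((mℓ - r : ℕ) : ℝ) ^ 2) / (1 - η) with hein
  set eoffr : ℝ := (216 * (n₀ : ℝ) ^ 3) * (216 * (r : ℝ) ^ 3) * (CIR / ((r - n₀ : ℕ) : ℝ) ^ 2) ^ 2 with heoffr
  have heO0 : 0 ≤ eO := by rw [heO]; positivity
  have heI0 : 0 ≤ eI := by rw [heI]; positivity
  have heout0 : 0 ≤ eout := by rw [heout]; positivity
  have heoffR0 : 0 ≤ eoffR := by rw [heoffR]; positivity
  have hein0 : 0 ≤ ein := by rw [hein]; positivity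
  have heoffr0 : 0 ≤ eoffr := by rw [heoffr]; positivity
  -- (i) the sourceless part
  have hO : (∑ s ∈ univ.filter (fun s : ↥Λ => dist w s = (N₄ + 1 : ℕ)), ∑ z ∈ univ.filter (fun z : ↥Λ => dist w z = M₃),
        ecurrentSum (Kc Λ β) ({s} ∆ {z}) ^ 2 +
      ∑ s ∈ univ.filter (fun s : ↥Λ => dist w s = (m₀ + 1 : ℕ)), ∑ z ∈ univ.filter (fun z : ↥Λ => dist w z = n₀),
        ecurrentSum (Kc Λ β) ({s} ∆ {z}) ^ 2) / ecurrentSum (Kc Λ β) ∅ ^ 2 ≤ ENNReal.ofReal (eO + eI) := by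
    refine ENNReal.div_le_of_le_mul ?_
    rw [ENNReal.ofReal_add heO0 heI0, add_mul]
    exact add_le_add (offSum_le' hβ hS0 hIR hC w (by omega) (by omega)) (offSum_le' hβ hS0 hIR hC w hn₀ (by omega))
  -- (ii) the sourced parts
  have hX : ∀ {v y : ↥Λ}, mℓ ≤ Site.supNorm ((v : Site 4) - (w : Site 4)) → Site.supNorm ((v : Site 4) - (w : Site 4)) ≤ M₃ →
      sW ≤ twoPointFree 4 β ((v : Site 4) - (w : Site 4)) →
      (∀ p : Site 4, Site.supNorm p ≤ r →
        twoPointFree 4 β ((y : Site 4) - (w : Site 4) - p) ≤ θ * twoPointFree 4 β ((y : Site 4) - (v : Site 4))) →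
      (1 - η) * twoPointFree 4 β ((v : Site 4) - (w : Site 4)) ≤ boxTwoPt Λ β w v →
      (1 - η) * twoPointFree 4 β ((y : Site 4) - (v : Site 4)) ≤ boxTwoPt Λ β v y →
      (((∑ u ∈ univ.filter (fun u : ↥Λ => dist w u = R), ecurrentSum (Kc Λ β) ({w} ∆ {u}) * ecurrentSum (Kc Λ β) ({u} ∆ {v})) *
              ecurrentSum (Kc Λ β) ∅ +
            ecurrentSum (Kc Λ β) ({w} ∆ {v}) *
              ∑ s ∈ univ.filter (fun s : ↥Λ => dist w s = (N₄ + 1 : ℕ)), ∑ z ∈ univ.filter (fun z : ↥Λ => dist w z = R),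
                ecurrentSum (Kc Λ β) ({s} ∆ {z}) ^ 2) * ecurrentSum (Kc Λ β) ({v} ∆ {y}) +
          ecurrentSum (Kc Λ β) ({w} ∆ {v}) *
            ((∑ u ∈ univ.filter (fun u : ↥Λ => dist w u = r), ecurrentSum (Kc Λ β) ({v} ∆ {u}) * ecurrentSum (Kc Λ β) ({u} ∆ {y})) *
                ecurrentSum (Kc Λ β) ∅ +
              ecurrentSum (Kc Λ β) ({v} ∆ {y}) *
                ∑ s ∈ univ.filter (fun s : ↥Λ => dist w s = n₀), ∑ z ∈ univ.filter (fun z : ↥Λ => dist w z = r),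
                  ecurrentSum (Kc Λ β) ({s} ∆ {z}) ^ 2)) /
          (ecurrentSum (Kc Λ β) ({w} ∆ {v}) * ecurrentSum (Kc Λ β) ({v} ∆ {y}) * ecurrentSum (Kc Λ β) ∅ ^ 2) ≤
        ENNReal.ofReal (eout + eoffR + ein + eoffr) := by
    intro v y hvℓ hvM hSv hdom hlow_wv hlow_vy
    refine ENNReal.div_le_of_le_mul ?_
    have h1 := chainOut_mul_le hβ hS0 hIR hC w v hvM hMR hη1 hsW hSv hlow_wv (CIR := CIR)
    have h2 := offSum_le' hβ hS0 hIR hC w (b := R) (a := N₄ + 1) (by omega) (by omega) (CIR := CIR)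
    have h3 := chainIn_mul_le hβ hS0 hIR hC w v y (by omega) hrmℓ hvℓ hη1 hθ hdom hlow_vy (CIR := CIR)
    have h4 := offSum_le hβ hS0 hIR hC w hn₀ hn₀r (CIR := CIR)
    rw [← heout] at h1; rw [← heoffR] at h2; rw [← hein] at h3; rw [← heoffr] at h4
    calc _ ≤ (ENNReal.ofReal eout * (ecurrentSum (Kc Λ β) ({w} ∆ {v}) * ecurrentSum (Kc Λ β) ∅ ^ 2) +
              ecurrentSum (Kc Λ β) ({w} ∆ {v}) * (ENNReal.ofReal eoffR * ecurrentSum (Kc Λ β) ∅ ^ 2)) *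
              ecurrentSum (Kc Λ β) ({v} ∆ {y}) +
            ecurrentSum (Kc Λ β) ({w} ∆ {v}) *
              (ENNReal.ofReal ein * (ecurrentSum (Kc Λ β) ({v} ∆ {y}) * ecurrentSum (Kc Λ β) ∅ ^ 2) +
                ecurrentSum (Kc Λ β) ({v} ∆ {y}) * (ENNReal.ofReal eoffr * ecurrentSum (Kc Λ β) ∅ ^ 2)) := by
          gcongr
      _ = (ENNReal.ofReal eout + ENNReal.ofReal eoffR + ENNReal.ofReal ein + ENNReal.ofReal eoffr) *
            (ecurrentSum (Kc Λ β) ({w} ∆ {v}) * ecurrentSum (Kc Λ β) ({v} ∆ {y}) * ecurrentSum (Kc Λ β) ∅ ^ 2) := by ring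
      _ = _ := by
          rw [ENNReal.ofReal_add (by positivity) heoffr0, ENNReal.ofReal_add (by positivity) hein0,
            ENNReal.ofReal_add heout0 heoffR0]
  have hX₁ := hX hv₁ℓ hv₁M hSv₁ hdom₁ hlow_wv₁ hlow_vy₁
  have hX₂ := hX hv₂ℓ hv₂M hSv₂ hdom₂ hlow_wv₂ hlow_vy₂
  calc _ ≤ 2 * ENNReal.ofReal (eO + eI) + ENNReal.ofReal (eout + eoffR + ein + eoffr) +
        ENNReal.ofReal (eout + eoffR + ein + eoffr) := by gcongr
    _ = ENNReal.ofReal (2 * (eO + eI) + 2 * (eout + eoffR + ein + eoffr)) := by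
        conv_rhs => rw [ENNReal.ofReal_add (by positivity) (by positivity), ENNReal.ofReal_mul zero_le_two,
          ENNReal.ofReal_mul zero_le_two, ENNReal.ofReal_ofNat]
        ring

end Current

end Literature.Probability.LatticeModels

/-!
# The mixing core in a finite volume of `ℤ⁴`: (6.16) with all its inputs discharged (Aizenman–Duminil-Copin 2021, §6.2)

Topic `Literature/Probability/LatticeModels`. Theorems only; **no named fact is introduced** (D-0026).

M. Aizenman, H. Duminil-Copin, Ann. of Math. **194** (2021) = arXiv:1912.07973, §6.2, the inequality (6.16):
"Gathering (6.13)–(6.15) as well as Lemma 6.7, and observing that the sum on `(u₁,…,u_t)` of `δ(𝐮,𝐱,𝐲)`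
is `1`, we obtain that `|P^{𝐱𝐲}[E ∩ F] - ∑_𝐮 δ(𝐮,𝐱,𝐲) P^{𝐱𝐮}[E] P^{𝐮𝐲}[F]| ≤ C₅s/√log(N/n) + 2C₆s(n/N)^ε`".

The tree's `Current.mixingCore_prob` (`RandomCurrentsMixingEndgame`) is the abstract form of (6.16) on a finite
graph, with the concentration bounds (`hc`, `hB`), the split-event bound (`hG`) and the positivity of the
normalisation as hypotheses. This file discharges them on the induced graph of a finite `Λ ⊆ ℤ⁴` with constant
couplings `β` for the case `t = 2`, `s = 4`, centre sources `x₁ = x₂ = w` (the case used in §6.1): the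
coefficients are `Current.mixCoeff` (`MixingBoxConcentration`: `hc` exactly, `hB` from the two-site numerics
(6.5) and the comparison `(1-η)S ≤ ⟨·⟩_Λ ≤ S`), and `hG` is `Current.splitFail_hG_real`
(`MixingBoxSplitNumerics`: Lemma 6.7 through the Infrared Bound). The result,
`Current.box_mixingCore_prob`, is (6.16) on `Λ` with the explicit error `√(q²-1) + E`
(`q = (1-η)⁻⁵(1 + C_*/|𝒦|)` the second-moment bound, `E` the split-event bound), for every pair of index
families of switch points satisfying the hypotheses of (6.5) and of `𝔸_y` — all deterministic, for a fixed
finite volume containing the points involved.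

## References

* M. Aizenman, H. Duminil-Copin, Ann. of Math. 194 (2021), arXiv:1912.07973, §6.2, (6.13)–(6.16), Prop. 6.6,
  Lemma 6.7 (pp. 23–25) [AizenmanDuminilCopinAnnals2021].
-/

noncomputable section

open Finset Filter
open scoped symmDiff ENNReal

namespace Literature.Probability.LatticeModels

namespace Current

variable {Λ : Finset (Site 4)} {β : ℝ}

/-- `q·q ≤ 1 + ρ²` with `ρ = √(q²-1)` for `q ≥ 1`, in `ℝ≥0∞`. [folklore] -/
theorem ofReal_mul_self_le_one_add_sq {q : ℝ} (hq : 1 ≤ q) :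
    ENNReal.ofReal q * ENNReal.ofReal q ≤ 1 + ENNReal.ofReal (Real.sqrt (q ^ 2 - 1)) ^ 2 := by
  rw [← ENNReal.ofReal_mul (by linarith), ← ENNReal.ofReal_pow (Real.sqrt_nonneg _), Real.sq_sqrt (by nlinarith),
    ← ENNReal.ofReal_one, ← ENNReal.ofReal_add zero_le_one (by nlinarith)]
  exact ENNReal.ofReal_le_ofReal (by nlinarith)

open Classical in
/-- **(6.16) in a finite volume of `ℤ⁴`, `t = 2`, `s = 4`, centre sources `x₁ = x₂ = w`.** Let `Λ ⊆ ℤ⁴` be finite,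
`β ≥ 0` with `S = S_β > 0` obeying `S(x) ≤ C_IR/‖x‖²`; `𝒦` a non-empty set of `(c,C)`-regular separated scales
with `2^k ≤ Y`; for each far source `yᵢ` (`dist(w,yᵢ) > N₄`) an index family `Iᵢ k ⊆ Ann(2^k,2^{k+1})` of size
`≥ γ2^{4k}`, inside `Λ - w`, with the domination hypotheses of (6.5) (`S(yᵢ-w) ≤ (1+κ2^k/Y)S(yᵢ-w-u)`) and of
Lemma 6.7 (`S(yᵢ-w-p) ≤ θS(yᵢ-w-u)` for `‖p‖ ≤ r`), `S ≥ s_W` on the blocks; radii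
`1 ≤ n₀ < r < m_ℓ ≤ 2^k`, `2^{k+1} ≤ M₃` (`k ∈ 𝒦`), `r ≤ m₀+1`, `n₀ ≤ m₀ ≤ M₃ < R ≤ N₄`; and the comparison
`(1-η)S ≤ ⟨·⟩_Λ` on the pairs `(w,yᵢ)`, `(w,v)`, `(v,yᵢ)` (`v` in the blocks). Then for `[0,1]`-valued
functionals `Φ` local inside `Λ_{n₀}(w)` and `Ψ` local outside `Λ_{N₄+1}(w)`:
`|P^{wy₁,wy₂}_Λ[ΦΨ] - ∑_{v₁,v₂} δ(v₁,v₂) P^{wv₁,wv₂}_Λ[Φ] P^{v₁y₁,v₂y₂}_Λ[Ψ]| ≤ √(q²-1) + E`, with the switch weights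
`δ = Current.switchWeight` of the coefficients `Current.mixCoeff`, `q = (1-η)⁻⁵(1 + C_*/|𝒦|)` and `E` the bound of
`splitFail_hG_real`. [cite: AizenmanDuminilCopinAnnals2021, arXiv:1912.07973 §6.2, (6.16) (p. 25), with Prop. 6.6 and Lemma 6.7] -/
theorem box_mixingCore_prob (hβ : 0 ≤ β) (hS : ∀ z, 0 < twoPointFree 4 β z) {CIR : ℝ}
    (hIR : ∀ x : Site 4, x ≠ 0 → twoPointFree 4 β x ≤ CIR / (Site.supNorm x : ℝ) ^ 2) (hCIR : 0 ≤ CIR)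
    (w y₁ y₂ : ↥Λ) (𝒦 : Finset ℕ) (I₁ I₂ : ℕ → Finset (Site 4))
    {c C κ Y γ η sW θ : ℝ} (hc : 0 < c) (hC : 0 ≤ C) (hκ : 0 ≤ κ) (hγ : 0 < γ) (hη0 : 0 ≤ η) (hη1 : η < 1)
    (hsW : 0 < sW) (hθ : 0 ≤ θ)
    (h𝒦 : 𝒦.Nonempty) (hreg : ∀ j ∈ 𝒦, IsRegularScale (twoPointFree 4 β) c C (2 ^ j))
    (hsep : ∀ j ∈ 𝒦, ∀ j' ∈ 𝒦, j < j' → (C + 2) * 2 ^ j < (2 ^ j' : ℝ)) (hY : ∀ j ∈ 𝒦, (2 ^ j : ℝ) ≤ Y)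
    (hI₁ : ∀ j ∈ 𝒦, I₁ j ⊆ ann 4 (2 ^ j) (2 * 2 ^ j)) (hI₂ : ∀ j ∈ 𝒦, I₂ j ⊆ ann 4 (2 ^ j) (2 * 2 ^ j))
    (hcard₁ : ∀ j ∈ 𝒦, γ * (2 ^ j : ℝ) ^ 4 ≤ #(I₁ j)) (hcard₂ : ∀ j ∈ 𝒦, γ * (2 ^ j : ℝ) ^ 4 ≤ #(I₂ j))
    (hdom₁ : ∀ j ∈ 𝒦, ∀ u ∈ I₁ j, twoPointFree 4 β ((y₁ : Site 4) - w) ≤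
      (1 + κ * 2 ^ j / Y) * twoPointFree 4 β ((y₁ : Site 4) - w - u))
    (hdom₂ : ∀ j ∈ 𝒦, ∀ u ∈ I₂ j, twoPointFree 4 β ((y₂ : Site 4) - w) ≤
      (1 + κ * 2 ^ j / Y) * twoPointFree 4 β ((y₂ : Site 4) - w - u))
    (hIΛ₁ : ∀ j ∈ 𝒦, ∀ u ∈ I₁ j, (w : Site 4) + u ∈ Λ) (hIΛ₂ : ∀ j ∈ 𝒦, ∀ u ∈ I₂ j, (w : Site 4) + u ∈ Λ)
    {n₀ r mℓ m₀ M₃ R N₄ : ℕ} (hn₀ : 1 ≤ n₀) (hn₀r : n₀ < r) (hrmℓ : r < mℓ) (hrm : r ≤ m₀ + 1) (h12 : n₀ ≤ m₀)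
    (h23 : m₀ ≤ M₃) (hMR : M₃ < R) (hRN : R ≤ N₄)
    (hmℓ𝒦 : ∀ j ∈ 𝒦, mℓ ≤ 2 ^ j) (hM𝒦 : ∀ j ∈ 𝒦, 2 * 2 ^ j ≤ M₃)
    (hy₁ : (N₄ : ℝ) < dist w y₁) (hy₂ : (N₄ : ℝ) < dist w y₂)
    (hdomθ₁ : ∀ j ∈ 𝒦, ∀ u ∈ I₁ j, ∀ p : Site 4, Site.supNorm p ≤ r →
      twoPointFree 4 β ((y₁ : Site 4) - w - p) ≤ θ * twoPointFree 4 β ((y₁ : Site 4) - w - u))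
    (hdomθ₂ : ∀ j ∈ 𝒦, ∀ u ∈ I₂ j, ∀ p : Site 4, Site.supNorm p ≤ r →
      twoPointFree 4 β ((y₂ : Site 4) - w - p) ≤ θ * twoPointFree 4 β ((y₂ : Site 4) - w - u))
    (hsW₁ : ∀ j ∈ 𝒦, ∀ u ∈ I₁ j, sW ≤ twoPointFree 4 β u) (hsW₂ : ∀ j ∈ 𝒦, ∀ u ∈ I₂ j, sW ≤ twoPointFree 4 β u)
    (hlow_wy₁ : (1 - η) * twoPointFree 4 β ((y₁ : Site 4) - w) ≤ boxTwoPt Λ β w y₁)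
    (hlow_wy₂ : (1 - η) * twoPointFree 4 β ((y₂ : Site 4) - w) ≤ boxTwoPt Λ β w y₂)
    (hlow_blk₁ : ∀ j ∈ 𝒦, ∀ v ∈ blk w I₁ j,
      (1 - η) * twoPointFree 4 β ((v : Site 4) - w) ≤ boxTwoPt Λ β w v ∧
        (1 - η) * twoPointFree 4 β ((y₁ : Site 4) - v) ≤ boxTwoPt Λ β v y₁)
    (hlow_blk₂ : ∀ j ∈ 𝒦, ∀ v ∈ blk w I₂ j,
      (1 - η) * twoPointFree 4 β ((v : Site 4) - w) ≤ boxTwoPt Λ β w v ∧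
        (1 - η) * twoPointFree 4 β ((y₂ : Site 4) - v) ≤ boxTwoPt Λ β v y₂)
    {Φ Ψ : FourCfg (boxGraph Λ) → ℝ≥0∞} (hΦ1 : ∀ pq, Φ pq ≤ 1) (hΨ1 : ∀ pq, Ψ pq ≤ 1)
    (hΦ : FourLocal (edgesWithin (G := boxGraph Λ) w n₀) Φ) (hΨ : FourLocal (edgesBeyond (G := boxGraph Λ) w (N₄ + 1)) Ψ) :
    |srcProb (Kc Λ β) ({w} ∆ {y₁}) ({w} ∆ {y₂}) (Φ * Ψ) -
      ∑ v₁, ∑ v₂, switchWeight (Kc Λ β) w w y₁ y₂ (mixCoeff β w y₁ 𝒦 I₁) (mixCoeff β w y₂ 𝒦 I₂) v₁ v₂ *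
        (srcProb (Kc Λ β) ({w} ∆ {v₁}) ({w} ∆ {v₂}) Φ * srcProb (Kc Λ β) ({v₁} ∆ {y₁}) ({v₂} ∆ {y₂}) Ψ)| ≤
      Real.sqrt (((1 - η)⁻¹ ^ 5 * (1 + ((2 * C * ((1 + (1 + c) / c) * 9 ^ 4 * C ^ 2 * (1 + κ) / γ)) +
          4 * ((1 + κ) * C + (2 * C + κ + 2 * C * κ))) / #𝒦)) ^ 2 - 1) +
      (2 * ((216 * (M₃ : ℝ) ^ 3) * (216 * ((N₄ + 1 : ℕ) : ℝ) ^ 3) * (CIR / ((N₄ + 1 - M₃ : ℕ) : ℝ) ^ 2) ^ 2 +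
            (216 * (n₀ : ℝ) ^ 3) * (216 * ((m₀ + 1 : ℕ) : ℝ) ^ 3) * (CIR / ((m₀ + 1 - n₀ : ℕ) : ℝ) ^ 2) ^ 2) +
          2 * ((216 * (R : ℝ) ^ 3) * ((CIR / (R : ℝ) ^ 2) * (CIR / ((R - M₃ : ℕ) : ℝ) ^ 2)) / ((1 - η) * sW) +
            (216 * (R : ℝ) ^ 3) * (216 * ((N₄ + 1 : ℕ) : ℝ) ^ 3) * (CIR / ((N₄ + 1 - R : ℕ) : ℝ) ^ 2) ^ 2 +
            θ * (216 * (r : ℝ) ^ 3) * (CIR / ((mℓ - r : ℕ) : ℝ) ^ 2) / (1 - η) +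
            (216 * (n₀ : ℝ) ^ 3) * (216 * (r : ℝ) ^ 3) * (CIR / ((r - n₀ : ℕ) : ℝ) ^ 2) ^ 2)) := by
  classical
  have hK : ∀ e, 0 ≤ Kc Λ β e := fun _ => hβ
  have hS0 : ∀ z, 0 ≤ twoPointFree 4 β z := fun z => (hS z).le
  have h1η : 0 < 1 - η := by linarith
  have hZtop : ∀ A, ecurrentSum (Kc Λ β) A ≠ ∞ := fun A => ecurrentSum_ne_top hK A
  have hZ0 : ecurrentSum (Kc Λ β) (∅ : Finset ↥Λ) ≠ 0 := ecurrentSum_empty_ne_zero _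
  -- a bond ranking
  obtain ⟨rk, hrk⟩ : ∃ rk : (boxGraph Λ).edgeFinset → ℕ, Function.Injective rk :=
    ⟨fun e => (Fintype.equivFin _ e : ℕ), fun a b h => (Fintype.equivFin _).injective (Fin.ext h)⟩
  -- positivity of pair sums from the comparison with `S > 0`
  have hTpos_of : ∀ {a b : ↥Λ} {x : Site 4}, (1 - η) * twoPointFree 4 β x ≤ boxTwoPt Λ β a b →
      ecurrentSum (Kc Λ β) ({a} ∆ {b}) ≠ 0 := by
    intro a b x h h0
    have hpos : 0 < boxTwoPt Λ β a b := lt_of_lt_of_le (mul_pos h1η (hS x)) h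
    rw [boxTwoPt_eq_div hβ, h0, ENNReal.toReal_zero, zero_div] at hpos
    exact lt_irrefl _ hpos
  -- the blocks: membership facts
  have hblkmem : ∀ {I : ℕ → Finset (Site 4)} {j : ℕ} {v : ↥Λ}, v ∈ blk w I j ↔ ((v : Site 4) - w) ∈ I j := by
    intro I j v; unfold blk; simp
  -- block sums are non-zero
  have hblk_ne : ∀ {I : ℕ → Finset (Site 4)} {y : ↥Λ}, (∀ j ∈ 𝒦, γ * (2 ^ j : ℝ) ^ 4 ≤ #(I j)) →
      (∀ j ∈ 𝒦, ∀ u ∈ I j, (w : Site 4) + u ∈ Λ) →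
      (∀ j ∈ 𝒦, ∀ v ∈ blk w I j, (1 - η) * twoPointFree 4 β ((v : Site 4) - w) ≤ boxTwoPt Λ β w v ∧
        (1 - η) * twoPointFree 4 β ((y : Site 4) - v) ≤ boxTwoPt Λ β v y) →
      ∀ j ∈ 𝒦, blkSum β w y I j ≠ 0 := by
    intro I y hcard hIΛ hlow j hj
    have hne : (blk w I j).Nonempty := by
      rw [← Finset.card_pos]
      have h1 : (0 : ℝ) < #(I j) := lt_of_lt_of_le (by positivity) (hcard j hj)
      rw [← card_blk_eq w I j (hIΛ j hj)] at h1
      exact_mod_cast h1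
    obtain ⟨v, hv⟩ := hne
    unfold blkSum
    intro h0
    have := Finset.sum_eq_zero_iff.1 h0 v hv
    rcases mul_eq_zero.1 this with h | h
    · exact hTpos_of (hlow j hj v hv).1 h
    · exact hTpos_of (hlow j hj v hv).2 h
  have hblk₁ := hblk_ne hcard₁ hIΛ₁ hlow_blk₁
  have hblk₂ := hblk_ne hcard₂ hIΛ₂ hlow_blk₂
  -- (hc), finiteness
  have hc₁ := sum_mixCoeff_mul w y₁ 𝒦 I₁ hβ h𝒦 hblk₁
  have hc₂ := sum_mixCoeff_mul w y₂ 𝒦 I₂ hβ h𝒦 hblk₂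
  have htop₁ := mixCoeff_ne_top w y₁ 𝒦 I₁ hβ hblk₁
  have htop₂ := mixCoeff_ne_top w y₂ 𝒦 I₂ hβ hblk₂
  -- (hB)
  have i₀ : Fin 4 := ⟨0, by norm_num⟩
  have hB₁ := mixCoeff_secondMoment_le w y₁ 𝒦 I₁ hβ hS i₀ hc hC hκ hγ hη1 h𝒦 hreg hsep hY hI₁ hcard₁ hdom₁ hIΛ₁
    hlow_wy₁ hlow_blk₁
  have hB₂ := mixCoeff_secondMoment_le w y₂ 𝒦 I₂ hβ hS i₀ hc hC hκ hγ hη1 h𝒦 hreg hsep hY hI₂ hcard₂ hdom₂ hIΛ₂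
    hlow_wy₂ hlow_blk₂
  set q : ℝ := (1 - η)⁻¹ ^ 5 * (1 + ((2 * C * ((1 + (1 + c) / c) * 9 ^ 4 * C ^ 2 * (1 + κ) / γ)) +
    4 * ((1 + κ) * C + (2 * C + κ + 2 * C * κ))) / #𝒦) with hq
  have hq1 : 1 ≤ q := by
    rw [hq]
    have h1 : 1 ≤ (1 - η)⁻¹ ^ 5 := one_le_pow₀ (by rw [le_inv_comm₀ one_pos h1η, inv_one]; linarith)
    have h2 : (1 : ℝ) ≤ 1 + ((2 * C * ((1 + (1 + c) / c) * 9 ^ 4 * C ^ 2 * (1 + κ) / γ)) +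
        4 * ((1 + κ) * C + (2 * C + κ + 2 * C * κ))) / #𝒦 := by
      have : (0 : ℝ) ≤ ((2 * C * ((1 + (1 + c) / c) * 9 ^ 4 * C ^ 2 * (1 + κ) / γ)) +
        4 * ((1 + κ) * C + (2 * C + κ + 2 * C * κ))) / #𝒦 := by positivity
      linarith
    nlinarith
  have hρ := ofReal_mul_self_le_one_add_sq hq1
  -- (hG)
  have hG : ∀ v₁ v₂ : ↥Λ, mixCoeff β w y₁ 𝒦 I₁ v₁ ≠ 0 → mixCoeff β w y₂ 𝒦 I₂ v₂ ≠ 0 →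
      ∑' ω : OctoCfg (boxGraph Λ), octoWeightSw (Kc Λ β) w w w y₁ y₂ v₁ v₂ ω *
          splitFailInd (edgesWithin (G := boxGraph Λ) w n₀) (edgesBeyond (G := boxGraph Λ) w (N₄ + 1))
            (octoU w v₁ v₂) (octoY w y₁ y₂) ω ≤
        ENNReal.ofReal (2 * ((216 * (M₃ : ℝ) ^ 3) * (216 * ((N₄ + 1 : ℕ) : ℝ) ^ 3) * (CIR / ((N₄ + 1 - M₃ : ℕ) : ℝ) ^ 2) ^ 2 +
            (216 * (n₀ : ℝ) ^ 3) * (216 * ((m₀ + 1 : ℕ) : ℝ) ^ 3) * (CIR / ((m₀ + 1 - n₀ : ℕ) : ℝ) ^ 2) ^ 2) +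
          2 * ((216 * (R : ℝ) ^ 3) * ((CIR / (R : ℝ) ^ 2) * (CIR / ((R - M₃ : ℕ) : ℝ) ^ 2)) / ((1 - η) * sW) +
            (216 * (R : ℝ) ^ 3) * (216 * ((N₄ + 1 : ℕ) : ℝ) ^ 3) * (CIR / ((N₄ + 1 - R : ℕ) : ℝ) ^ 2) ^ 2 +
            θ * (216 * (r : ℝ) ^ 3) * (CIR / ((mℓ - r : ℕ) : ℝ) ^ 2) / (1 - η) +
            (216 * (n₀ : ℝ) ^ 3) * (216 * (r : ℝ) ^ 3) * (CIR / ((r - n₀ : ℕ) : ℝ) ^ 2) ^ 2)) *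
        ∑' ω : OctoCfg (boxGraph Λ), octoWeightSw (Kc Λ β) w w w y₁ y₂ v₁ v₂ ω := by
    intro v₁ v₂ h₁ h₂
    obtain ⟨k₁, hk₁, hu₁⟩ := exists_mem_of_mixCoeff_ne_zero w y₁ 𝒦 I₁ h₁
    obtain ⟨k₂, hk₂, hu₂⟩ := exists_mem_of_mixCoeff_ne_zero w y₂ 𝒦 I₂ h₂
    have hv₁blk : v₁ ∈ blk w I₁ k₁ := hblkmem.2 hu₁
    have hv₂blk : v₂ ∈ blk w I₂ k₂ := hblkmem.2 hu₂
    -- norms of the switch points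
    have hnorm : ∀ {I : ℕ → Finset (Site 4)} {k : ℕ} {v : ↥Λ}, k ∈ 𝒦 → (∀ j ∈ 𝒦, I j ⊆ ann 4 (2 ^ j) (2 * 2 ^ j)) →
        ((v : Site 4) - (w : Site 4)) ∈ I k →
        mℓ ≤ Site.supNorm ((v : Site 4) - (w : Site 4)) ∧ Site.supNorm ((v : Site 4) - (w : Site 4)) ≤ M₃ := by
      intro I k v hk hI hu
      have h := hI k hk hu
      rw [mem_ann] at h
      exact ⟨(hmℓ𝒦 k hk).trans h.1, h.2.trans (hM𝒦 k hk)⟩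
    obtain ⟨hv₁ℓ, hv₁M⟩ := hnorm hk₁ hI₁ hu₁
    obtain ⟨hv₂ℓ, hv₂M⟩ := hnorm hk₂ hI₂ hu₂
    obtain ⟨hl₁, hl₁'⟩ := hlow_blk₁ k₁ hk₁ v₁ hv₁blk
    obtain ⟨hl₂, hl₂'⟩ := hlow_blk₂ k₂ hk₂ v₂ hv₂blk
    refine splitFail_hG_real hβ hS0 hIR hCIR hrk w hn₀ hn₀r hrmℓ hrm h12 h23 hMR hRN hv₁ℓ hv₁M hv₂ℓ hv₂M hy₁ hy₂ hη1
      hsW hθ (hsW₁ k₁ hk₁ _ hu₁) (hsW₂ k₂ hk₂ _ hu₂) (fun p hp => ?_) (fun p hp => ?_) hl₁ hl₂ ?_ ?_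
      (mul_ne_zero (hTpos_of hl₁) (hTpos_of hl₁')) (mul_ne_zero (hTpos_of hl₂) (hTpos_of hl₂'))
      (fun e he z hz => ?_) (fun e he => ?_)
    · have h := hdomθ₁ k₁ hk₁ _ hu₁ p hp
      rwa [show (y₁ : Site 4) - w - ((v₁ : Site 4) - w) = (y₁ : Site 4) - v₁ by abel] at h
    · have h := hdomθ₂ k₂ hk₂ _ hu₂ p hp
      rwa [show (y₂ : Site 4) - w - ((v₂ : Site 4) - w) = (y₂ : Site 4) - v₂ by abel] at h
    · exact hl₁'
    · exact hl₂'
    · unfold edgesWithin at he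
      exact (mem_filter.1 he).2 z hz
    · unfold edgesBeyond at he
      refine ⟨(e : Sym2 ↥Λ).out.1, Sym2.out_fst_mem _, ?_⟩
      have h := (mem_filter.1 he).2 _ (Sym2.out_fst_mem (e : Sym2 ↥Λ))
      push_cast at h
      linarith
  -- positivity of the normalisation
  have hN : srcNrm (Kc Λ β) ({w} ∆ {y₁}) ({w} ∆ {y₂}) ≠ 0 := by
    unfold srcNrm
    exact mul_ne_zero (mul_ne_zero hZ0 (hTpos_of hlow_wy₁)) (mul_ne_zero hZ0 (hTpos_of hlow_wy₂))
  -- the core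
  have h := mixingCore_prob hK (edgesWithin (G := boxGraph Λ) w n₀) (edgesBeyond (G := boxGraph Λ) w (N₄ + 1)) w w w y₁ y₂
    htop₁ htop₂ hc₁ hc₂ ENNReal.ofReal_ne_top ENNReal.ofReal_ne_top hB₁ hB₂ hρ hG hN hΦ1 hΨ1 hΦ hΨ
  rw [ENNReal.toReal_ofReal (Real.sqrt_nonneg _), ENNReal.toReal_ofReal (by positivity)] at h
  exact h

end Current

end Literature.Probability.LatticeModels
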